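import Summits.Ventures.CertifiedManyBodySolver.Observables.StiffnessKinematicLeaf
import Summits.HubbardSuperconductivity.HubbardLadder.Bounds.HalfBathtubStiffnessBoundTL
import Literature.MathematicalPhysics.StatisticalMechanics.KosterlitzThoulessStiffnessBound
import HarnessLib

/-!
# Ventures/CertifiedManyBodySolver — Observables/StiffnessThermalLeaf.lean

HONEST FRAMING: one-sided CEILINGS on the THERMAL (positive-temperature) uniform flux stiffness of the strictly
two-dimensional one-band `t–t′` Hubbard torus, and the Kosterlitz–Thouless-type UPPER bound on a transition temperature they
give WITHOUT any monotonicity-in-temperature assumption; CONDITIONAL on the named KT inputs (stability / universal jump,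
identification) exactly as printed; a ceiling never speaks to the presence of order; not a `T_c` estimate, not a
superconductivity verdict; a MATERIAL ceiling only through a separately stated 2D → 3D transfer assumption.

Cell `hubbard-tc` (MO-S3 ORDER → `T_c` back-end, D-0096), seat p1, `prover-hubbard-tc-p1-g0-0`; the cell's key K1t
(«thermal kinetic ceiling, no monotonicity», referee R3/R9, VERDICTS.md §7/§13) in the kernel.

**Why.** The ground-state stiffness leaves (`ObsStiffnessSeqCeilingAt tp U n c`, `Observables/RungLeavesStiffnessAnchor.lean`) bound
flux-stiffness constants of the sector GROUND states; turning such a ceiling into `T_c ≤ (π/4)·c` (p2, `Observables/KTTransitionCeiling.lean`,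
`KTDictionaryAt.le_pi_div_four_mul`) needs the monotonicity hypothesis K3 (`ρₑ(T) ≤ ρₑ(0)`, Hazra–Verma–Randeria's stated assumption).
The KINEMATIC (one-body, half-bathtub) ceiling, however, holds at EVERY temperature: pub-hubbard's
`Summit.HubbardSuperconductivity.HubbardLadder.Bounds.thermalHalfBathtubStiffnessBoundTL_holds` (finite torus `L ≥ 3`, every `β > 0`,
canonical `(N_L, S^z = 0)` sector, Paramekanti–Trivedi–Randeria's thermal f-sum bound eq. (3) + the one-body bathtub, with the explicit
rate `(|ν| + 2π(1 + 4|t′|))/L`). This file: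

* §1 `thermalFluxLogZ L tp U δ β θ` — the sector log-partition function `log Z_p(θ)` of the flux-twisted torus (`p` = the
  `(N_L, S^z = 0)` coordinate sector, `N_L = 2⌊(1−δ)L²/2⌋`, the binder of the pub-hubbard theorem), so that the thermal stiffness
  hypothesis reads `β ρ_s θ² ≤ log Z_p(0) − log Z_p(θ)` (`= β(F_p(θ) − F_p(0))`);
* §2 `ObsThermalStiffnessSeqCeilingAt tp U n c` — **the thermal sequence-robust stiffness leaf**: for EVERY inverse temperature `β > 0`,
  every `ρ_s > 0` (scale `θ₀ > 0`) whose thermal flux inequality holds along some sequence of sides `L_j → ∞` satisfies `ρ_s ≤ c`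
  (the `T > 0` twin of `ObsStiffnessSeqCeilingAt`; filling `n = 1 − δ`);
* §3 `thermalFluxStiffness_le_halfBathtub_seq` — the `L → ∞` passage (the rate term is removed by `Filter.Tendsto.div_atTop`, literally
  the proof of `fluxStiffness_le_halfBathtub_seq` with the thermal hypothesis): `ρ_s ≤ ν·n/2 + B(t′, ν)`,
  `B(t′, ν) = (4π²)⁻¹∫_{−π}^{π}∫_{−π}^{π}(cos x + cos y + 4t′ cos x cos y − ν)⁺ dx dy`, for EVERY `ν`, every `β > 0`, any `t′`, `U`,
  `0 ≤ n ≤ 2`; the hook `ObsThermalStiffnessSeqCeilingAt_of_halfBathtub_le` (`ν·n/2 + B(t′, ν) ≤ c` ⇒ leaf; the interval-certified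
  box suprema of the cell's B3-CERTIFIED.md are values of exactly this `c`); the `ν = 0` instances `…_of_kinL1_le` (`c ≥ kinL1 t′/4`,
  `bzInt_bathtubSymbolTT'_zero`) and, at `t′ = 0`, the UNCONDITIONAL thermal kinematic leaf `…_tp0_kinematic` (`c ≥ 4/π²`) with its
  decimal `…_tp0_kinematic_decimal` (`0.4052848`);
* §4 `IsThermalFluxStiffnessSeqAt tp U n β ρ` — the thermal identification (key K1t): `ρ` is (at most) a thermal flux-stiffness
  constant at inverse temperature `β` (every level `0 < r < ρ` satisfies the thermal flux inequality on some window along some sequence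
  of sides); `….le_of_leaf`;
* §5 `ThermalKTDictionaryAt tp U n ρₑ Tc` — the KT dictionary WITHOUT K3: `pos` (`0 < Tc`), `stable` (K2, `KosterlitzThouless.StableBelow`
  for the PAIR stiffness `ρₑ/2 = phaseStiffnessOfTwistCoeff 2 ρₑ`, p1's Literature file), `thermal` (K1t: at every `T ∈ (0, Tc)` the
  profile value `ρₑ(T)` is identified with a thermal flux-stiffness constant at `β = 1/T`). PROVED: `….le_pi_div_four_mul` — **thermal
  leaf + dictionary ⇒ `Tc ≤ (π/4)·c`, no monotonicity**; `….le_pi_div_four_mul_of_halfBathtub_le` (the cell's B3/B-x row grammar: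
  `ν·n/2 + B(t′,ν) ≤ c` ⇒ `Tc ≤ (π/4)c`); `….le_inv_pi_kinematic` — **`t′ = 0`, every `U`, every `0 ≤ n ≤ 2`: `Tc ≤ 1/π`** (TC-TABLE A1,
  now K3-free in the kernel); `….le_pi_mul_kinL1_div_sixteen` (any `t′`: `Tc ≤ π·kinL1 t′/16`); `….layered_le_mul_pi_div_four_mul`
  (K4-b transfer `T₃ ≤ E·Tc` printed as a hypothesis).

Every theorem is CONDITIONAL on the leaf fed in and on the dictionary fields, which are HYPOTHESES (renormalisation-group input
and the identification), not theorems of the Hubbard model. Two definitions of predicates/quantities, no named fact, zero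
computation, no `sorry`.

References: A. Paramekanti, N. Trivedi, M. Randeria, PRB 57 (1998) 11639, eq. (3), §IV [ParamekantiTrivediRanderia1998];
T. Hazra, N. Verma, M. Randeria, PRX 9 (2019) 031049, eqs. (2)–(4), App. A, G [HazraVermaRanderia2019]; D. R. Nelson,
J. M. Kosterlitz, PRL 39 (1977) 1201 [NelsonKosterlitz1977]; D. J. Scalapino, S. R. White, S.-C. Zhang, PRB 47 (1993) 7995, §II
[ScalapinoWhiteZhang1993].
-/

noncomputable section

namespace Summit.Ventures.CertifiedManyBodySolver.Observables

open Filter Topology Set Real MeasureTheory Matrix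
open Literature.MathematicalPhysics.QuantumLattice
open Literature.MathematicalPhysics.QuantumFieldTheory
open Literature.Probability.LatticeModels
open Literature.MathematicalPhysics.StatisticalMechanics
open Literature.MathematicalPhysics.StatisticalMechanics.KosterlitzThouless
open Summit.HubbardSuperconductivity.HubbardLadder.Bounds
open scoped ComplexConjugate ComplexOrder

/-! ## §1 The sector log-partition function of the flux-twisted torus -/

/-- **`log Z_p(θ)` of the flux-twisted `t–t′` torus in the canonical sector.** For a side `L`, couplings `(1, tp, U)`, doping `δ`
(filling `n = 1 − δ`), inverse temperature `β` and total seam flux `θ`: the real part of the logarithm of the partition function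
`Matrix.partitionFn β` of the compression of `hubbardTorusTT'Flux L tp U θ` to the coordinate sector `p` of
`N_L = 2⌊(1−δ)L²/2⌋` electrons with `S^z = 0` (`|s| = N_L`, `2·#{i ∈ s : spin i = 0} = N_L` — the binder of pub-hubbard's
`ThermalHalfBathtubStiffnessBoundTL`). `−β⁻¹·thermalFluxLogZ` is the sector free energy `F_p(θ)`; its curvature in `θ` is the thermal
superfluid stiffness of Scalapino–White–Zhang §II at `T = 1/β`. [cite: ScalapinoWhiteZhang1993, §II] -/
def thermalFluxLogZ (L : ℕ) [NeZero L] (tp U δ β θ : ℝ) : ℝ :=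
  Real.log (partitionFn β ((hubbardTorusTT'Flux L tp U θ).toBlock
    (fun s : Finset (Orb (FermionTorus 2 L)) =>
      s.card = 2 * ⌊(1 - δ) * (L : ℝ) ^ 2 / 2⌋₊ ∧
        2 * (s.filter fun i => (ofLex i).2 = 0).card = 2 * ⌊(1 - δ) * (L : ℝ) ^ 2 / 2⌋₊)
    (fun s : Finset (Orb (FermionTorus 2 L)) =>
      s.card = 2 * ⌊(1 - δ) * (L : ℝ) ^ 2 / 2⌋₊ ∧
        2 * (s.filter fun i => (ofLex i).2 = 0).card = 2 * ⌊(1 - δ) * (L : ℝ) ^ 2 / 2⌋₊))).re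

/-! ## §2 The thermal sequence-robust stiffness leaf -/

/-- **Thermal sequence-robust stiffness ceiling `c` at the anchor `(U, n, t′)` (key K1t).** For EVERY inverse temperature `β > 0`,
every sequence of sides `L_j → ∞` and every `ρ_s > 0` (scale `θ₀ > 0`) with
`β ρ_s θ² ≤ log Z_{L_j}(0) − log Z_{L_j}(θ)` (`|θ| ≤ θ₀`; `log Z_L = thermalFluxLogZ L tp U (1 − n) β`, the `(N_L, S^z = 0)` sector,
`N_L = 2⌊nL²/2⌋`) at every side of the sequence, `ρ_s ≤ c` (tree units, `t = 1`, `k_B = 1`; Hazra–Verma–Randeria `D_s(T) = ρ_s/2`).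
The positive-temperature twin of `ObsStiffnessSeqCeilingAt`; reading: `limsup_L inf_{0<|θ|≤θ₀} (F_L(θ) − F_L(0))/θ² ≤ c` at every
temperature. [cite: ScalapinoWhiteZhang1993, §II] -/
def ObsThermalStiffnessSeqCeilingAt (tp U n : ℝ) (c : ℚ) : Prop :=
  ∀ (β ρs θ₀ : ℝ), 0 < β → 0 < ρs → 0 < θ₀ → ∀ Ls : ℕ → ℕ, Tendsto Ls atTop atTop →
    (∀ (j : ℕ) [NeZero (Ls j)] (θ : ℝ), |θ| ≤ θ₀ →
      β * ρs * θ ^ 2 ≤ thermalFluxLogZ (Ls j) tp U (1 - n) β 0 - thermalFluxLogZ (Ls j) tp U (1 - n) β θ) →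
    ρs ≤ ((c : ℚ) : ℝ)

/-- Monotone transport of the thermal leaf. -/
theorem ObsThermalStiffnessSeqCeilingAt.mono {tp U n : ℝ} {c c' : ℚ} (h : ObsThermalStiffnessSeqCeilingAt tp U n c)
    (hcc : c ≤ c') : ObsThermalStiffnessSeqCeilingAt tp U n c' :=
  fun β ρs θ₀ hβ hρs hθ₀ Ls hLs hst => (h β ρs θ₀ hβ hρs hθ₀ Ls hLs hst).trans (by exact_mod_cast hcc)

/-- **The "frequently" reading**: if, at some `β > 0`, the thermal flux inequality with constant `ρ_s > 0` (scale `θ₀ > 0`) holds at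
sides `L` that are merely unbounded, then already `ρ_s ≤ c`. [cite: ScalapinoWhiteZhang1993, §II] -/
theorem ObsThermalStiffnessSeqCeilingAt.le_of_frequently {tp U n : ℝ} {c : ℚ} (h : ObsThermalStiffnessSeqCeilingAt tp U n c)
    {β ρs θ₀ : ℝ} (hβ : 0 < β) (hρs : 0 < ρs) (hθ₀ : 0 < θ₀)
    (hfreq : ∃ᶠ L in atTop, ∀ [NeZero L], ∀ θ : ℝ, |θ| ≤ θ₀ →
      β * ρs * θ ^ 2 ≤ thermalFluxLogZ L tp U (1 - n) β 0 - thermalFluxLogZ L tp U (1 - n) β θ) :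
    ρs ≤ ((c : ℚ) : ℝ) := by
  obtain ⟨φ, hφ, hP⟩ := Filter.extraction_of_frequently_atTop hfreq
  exact h β ρs θ₀ hβ hρs hθ₀ φ hφ.tendsto_atTop fun j => @hP j

/-! ## §3 The `L → ∞` passage of the thermal half-bathtub ceiling, and the hooks -/

/-- **The thermal half-bathtub (one-body) stiffness ceiling along a sequence of sides, any `t′`, every temperature.** `0 ≤ n ≤ 2`,
any `t′`, `U`, `β > 0`; `Ls → ∞`; if `ρ_s > 0` (scale `θ₀ > 0`) satisfies `β ρ_s θ² ≤ log Z_{L_j}(0) − log Z_{L_j}(θ)` (`|θ| ≤ θ₀`) at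
every side of the sequence, then for every `ν ∈ ℝ`:
`ρ_s ≤ ν·n/2 + (4π²)⁻¹ ∫_{−π}^{π}∫_{−π}^{π} (cos x + cos y + 4t′ cos x cos y − ν)⁺ dx dy` — pub-hubbard's
`thermalHalfBathtubStiffnessBoundTL_holds` (Paramekanti–Trivedi–Randeria's thermal f-sum bound + the one-body bathtub) at each side
`L_j ≥ 3`, and the rate term `(|ν| + 2π(1 + 4|t′|))/L_j → 0`. No monotonicity in the temperature is involved.
[cite: ParamekantiTrivediRanderia1998, eq. (3) and §IV] -/
theorem thermalFluxStiffness_le_halfBathtub_seq (tp U n : ℝ) (hn0 : 0 ≤ n) (hn2 : n ≤ 2) {β ρs θ₀ : ℝ} (hβ : 0 < β)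
    (hρs : 0 < ρs) (hθ₀ : 0 < θ₀) {Ls : ℕ → ℕ} (hLs : Tendsto Ls atTop atTop)
    (hst : ∀ (j : ℕ) [NeZero (Ls j)] (θ : ℝ), |θ| ≤ θ₀ →
      β * ρs * θ ^ 2 ≤ thermalFluxLogZ (Ls j) tp U (1 - n) β 0 - thermalFluxLogZ (Ls j) tp U (1 - n) β θ) (ν : ℝ) :
    ρs ≤ ν * n / 2 +
      (∫ y in (-π)..π, ∫ x in (-π)..π,
          max (Real.cos x + Real.cos y + 4 * tp * (Real.cos x * Real.cos y) - ν) 0) / (4 * π ^ 2) := by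
  -- the finite-side bound with its `1/L` rate, eventually along the sequence
  have hev : ∀ᶠ j in atTop, ρs ≤ ν * n / 2 +
      (∫ y in (-π)..π, ∫ x in (-π)..π,
          max (Real.cos x + Real.cos y + 4 * tp * (Real.cos x * Real.cos y) - ν) 0) / (4 * π ^ 2) +
        (|ν| + 2 * π * (1 + 4 * |tp|)) / ((Ls j : ℕ) : ℝ) := by
    filter_upwards [hLs.eventually_ge_atTop 3] with j hj
    haveI : NeZero (Ls j) := ⟨by omega⟩
    have h := thermalHalfBathtubStiffnessBoundTL_holds (Ls j) hj tp U (1 - n) β ρs θ₀ (by linarith) (by linarith)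
      hβ hρs hθ₀
    dsimp only at h
    have h' := h (hst j) ν
    have hνn : ν * (1 - (1 - n)) / 2 = ν * n / 2 := by ring
    rw [hνn] at h'
    exact h'
  -- the rate term tends to zero
  have hrate : Tendsto (fun j => (|ν| + 2 * π * (1 + 4 * |tp|)) / ((Ls j : ℕ) : ℝ)) atTop (𝓝 0) :=
    tendsto_const_nhds.div_atTop (tendsto_natCast_atTop_atTop.comp hLs)
  have hlim : Tendsto (fun j => ν * n / 2 +
      (∫ y in (-π)..π, ∫ x in (-π)..π,
          max (Real.cos x + Real.cos y + 4 * tp * (Real.cos x * Real.cos y) - ν) 0) / (4 * π ^ 2) +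
        (|ν| + 2 * π * (1 + 4 * |tp|)) / ((Ls j : ℕ) : ℝ)) atTop
      (𝓝 (ν * n / 2 +
        (∫ y in (-π)..π, ∫ x in (-π)..π,
          max (Real.cos x + Real.cos y + 4 * tp * (Real.cos x * Real.cos y) - ν) 0) / (4 * π ^ 2) + 0)) :=
    tendsto_const_nhds.add hrate
  rw [add_zero] at hlim
  exact ge_of_tendsto hlim hev

/-- **Hook for a certified evaluation** (the cell's B3 / B-x row grammar, key K1t): if some `ν` and a rational `c` satisfy
`ν·n/2 + B(t′, ν) ≤ c`, then `ObsThermalStiffnessSeqCeilingAt tp U n c` (`0 ≤ n ≤ 2`, any `t′`, `U`; no claim node, every temperature).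
[cite: ParamekantiTrivediRanderia1998, eq. (3) and §IV] -/
theorem ObsThermalStiffnessSeqCeilingAt_of_halfBathtub_le (tp U n : ℝ) (hn0 : 0 ≤ n) (hn2 : n ≤ 2) (ν : ℝ) (c : ℚ)
    (hc : ν * n / 2 +
      (∫ y in (-π)..π, ∫ x in (-π)..π,
          max (Real.cos x + Real.cos y + 4 * tp * (Real.cos x * Real.cos y) - ν) 0) / (4 * π ^ 2) ≤ ((c : ℚ) : ℝ)) :
    ObsThermalStiffnessSeqCeilingAt tp U n c :=
  fun _β _ρs _θ₀ hβ hρs hθ₀ _Ls hLs hst =>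
    (thermalFluxStiffness_le_halfBathtub_seq tp U n hn0 hn2 hβ hρs hθ₀ hLs hst ν).trans hc

/-- **The `ν = 0` thermal leaf at any `t′`**: `ObsThermalStiffnessSeqCeilingAt tp U n c` for every rational `c ≥ kinL1 t′/4` (`0 ≤ n ≤ 2`,
any `U`), `kinL1 t′ = (4π²)⁻¹∫∫|2(cos x + cos y) + 8t′cos x cos y|` the certified one-body column of pub-hubbard
(`Bounds/KinSymbolIntegrals.lean`; at `ν = 0` the positive part integrates to `π²·kinL1 t′`, `bzInt_bathtubSymbolTT'_zero`). The half-filling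
optimum, valid at every filling. [cite: HazraVermaRanderia2019, eqs. (2)–(6)] -/
theorem ObsThermalStiffnessSeqCeilingAt_of_kinL1_le (tp U n : ℝ) (hn0 : 0 ≤ n) (hn2 : n ≤ 2) (c : ℚ)
    (hc : kinL1 tp / 4 ≤ ((c : ℚ) : ℝ)) : ObsThermalStiffnessSeqCeilingAt tp U n c := by
  refine ObsThermalStiffnessSeqCeilingAt_of_halfBathtub_le tp U n hn0 hn2 0 c ?_
  have hI : (∫ y in (-π)..π, ∫ x in (-π)..π,
      max (Real.cos x + Real.cos y + 4 * tp * (Real.cos x * Real.cos y) - 0) 0) = π ^ 2 * kinL1 tp :=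
    bzInt_bathtubSymbolTT'_zero tp
  rw [hI]
  have hπ : (π : ℝ) ≠ 0 := Real.pi_ne_zero
  have e : (0 : ℝ) * n / 2 + π ^ 2 * kinL1 tp / (4 * π ^ 2) = kinL1 tp / 4 := by
    field_simp
    ring
  rw [e]
  exact hc

/-- **THE THERMAL KINEMATIC STIFFNESS LEAF, UNCONDITIONAL** (`t′ = 0`, any coupling `U`, density `0 ≤ n ≤ 2`, EVERY temperature):
`ObsThermalStiffnessSeqCeilingAt 0 U n c` for every `c ≥ 4/π²` (`kinL1 0 = 16/π²`) — every thermal flux stiffness of the 2D Hubbard model at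
`t′ = 0`, at every `T > 0`, is `≤ 4/π² ≈ 0.4052847` tree units. No certificate, no claim node, no monotonicity.
[cite: HazraVermaRanderia2019, App. G] -/
theorem ObsThermalStiffnessSeqCeilingAt_tp0_kinematic {U n : ℝ} (hn0 : 0 ≤ n) (hn2 : n ≤ 2) (c : ℚ)
    (hc : 4 / Real.pi ^ 2 ≤ ((c : ℚ) : ℝ)) : ObsThermalStiffnessSeqCeilingAt 0 U n c := by
  refine ObsThermalStiffnessSeqCeilingAt_of_kinL1_le 0 U n hn0 hn2 c ?_
  rw [kinL1_zero]
  have hπ : (π : ℝ) ≠ 0 := Real.pi_ne_zero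
  have e : 16 / π ^ 2 / 4 = 4 / π ^ 2 := by
    field_simp
    norm_num
  rw [e]
  exact hc

/-- **Numerical thermal kinematic leaf**: `ObsThermalStiffnessSeqCeilingAt 0 U n 0.4052848` at EVERY `t′ = 0` anchor (`0 ≤ n ≤ 2`, any `U`),
every temperature, no premise (`4/π² ≤ 0.4052848`, `four_div_pi_sq_le_decimal`). [cite: HazraVermaRanderia2019, App. G] -/
theorem ObsThermalStiffnessSeqCeilingAt_tp0_kinematic_decimal {U n : ℝ} (hn0 : 0 ≤ n) (hn2 : n ≤ 2) :
    ObsThermalStiffnessSeqCeilingAt 0 U n (4052848 / 10000000) :=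
  ObsThermalStiffnessSeqCeilingAt_tp0_kinematic hn0 hn2 _ (by
    have h := four_div_pi_sq_le_decimal
    have he : (((4052848 / 10000000 : ℚ)) : ℝ) = (0.4052848 : ℝ) := by norm_num
    rw [he]; exact h)

/-! ## §4 The thermal identification (key K1t) -/

/-- **Thermal identification at inverse temperature `β` (key K1t).** `ρ` is (at most) a thermal uniform flux-stiffness constant of
the `(N_L, S^z = 0)` sector of `hubbardTorusTT' L 1 tp U` at inverse temperature `β`, in the sequence-robust sense of
`ObsThermalStiffnessSeqCeilingAt`: every level `0 < r < ρ` satisfies `β r θ² ≤ log Z_{L_j}(0) − log Z_{L_j}(θ)` for `|θ| ≤ θ₀` (some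
`θ₀ > 0`) along some sequence of sides `L_j → ∞`. This is how the cell reads «the pair stiffness `J(T) = ρₑ(T)/2` at temperature
`T = 1/β` IS the (thermodynamic-limit) free-energy flux curvature the thermal leaf bounds» (Hazra–Verma–Randeria `D_s(T)`; Scalapino–White–Zhang
§II at `T > 0`). A HYPOTHESIS on the profile, consumed by `ThermalKTDictionaryAt.thermal`. [cite: ScalapinoWhiteZhang1993, §II] -/
def IsThermalFluxStiffnessSeqAt (tp U n β ρ : ℝ) : Prop :=
  ∀ r : ℝ, 0 < r → r < ρ → ∃ θ₀ : ℝ, 0 < θ₀ ∧ ∃ Ls : ℕ → ℕ, Tendsto Ls atTop atTop ∧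
    ∀ (j : ℕ) [NeZero (Ls j)] (θ : ℝ), |θ| ≤ θ₀ →
      β * r * θ ^ 2 ≤ thermalFluxLogZ (Ls j) tp U (1 - n) β 0 - thermalFluxLogZ (Ls j) tp U (1 - n) β θ

/-- The thermal identification is monotone in the level. -/
theorem IsThermalFluxStiffnessSeqAt.mono {tp U n β ρ ρ' : ℝ} (h : IsThermalFluxStiffnessSeqAt tp U n β ρ) (hle : ρ' ≤ ρ) :
    IsThermalFluxStiffnessSeqAt tp U n β ρ' :=
  fun r hr hrρ => h r hr (hrρ.trans_le hle)

/-- **Thermal leaf + identification ⇒ the identified level is below the ceiling**: if `ρ > 0` is identified at some `β > 0` and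
`ObsThermalStiffnessSeqCeilingAt tp U n c` holds, then `ρ ≤ c`. [cite: ScalapinoWhiteZhang1993, §II] -/
theorem IsThermalFluxStiffnessSeqAt.le_of_leaf {tp U n β ρ : ℝ} {c : ℚ} (h : IsThermalFluxStiffnessSeqAt tp U n β ρ)
    (hβ : 0 < β) (hρ : 0 < ρ) (hleaf : ObsThermalStiffnessSeqCeilingAt tp U n c) : ρ ≤ ((c : ℚ) : ℝ) := by
  -- every level `r ∈ (0, ρ)` is `≤ c`
  have hr : ∀ r : ℝ, 0 < r → r < ρ → r ≤ ((c : ℚ) : ℝ) := by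
    intro r hr0 hrρ
    obtain ⟨θ₀, hθ₀, Ls, hLs, hst⟩ := h r hr0 hrρ
    exact hleaf β r θ₀ hβ hr0 hθ₀ Ls hLs hst
  have hc : 0 < ((c : ℚ) : ℝ) := lt_of_lt_of_le (half_pos hρ) (hr _ (half_pos hρ) (half_lt_self hρ))
  refine le_of_forall_lt_imp_le_of_dense fun r hrρ => ?_
  rcases le_or_gt r 0 with hr0 | hr0
  · exact hr0.trans hc.le
  · exact hr r hr0 hrρ

/-! ## §5 The thermal KT dictionary (K2 + K1t, no K3) and `T_c ≤ (π/4)·c` -/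

/-- **The monotonicity-free Kosterlitz–Thouless dictionary at the anchor `(U, n, t′)`** for a thermal ELECTRON twist-coefficient
profile `ρₑ : ℝ → ℝ` (free-energy cost `ρₑ(T)·θ²` of a total electron seam flux `θ` at temperature `T`, tree units, `t = 1`, `k_B = 1`;
pair-phase stiffness `J(T) = ρₑ(T)/2`) and a candidate transition temperature `Tc`:
* `pos` — `0 < Tc`;
* `stable` (K2) — the Kosterlitz–Thouless stability inequality `(2/π)·T ≤ J(T)` on `(0, Tc)` for the PAIR stiffness
  `J = phaseStiffnessOfTwistCoeff 2 ρₑ = ρₑ/2` (Nelson–Kosterlitz; a renormalisation-group HYPOTHESIS, `KosterlitzThouless.StableBelow`);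
* `thermal` (K1t) — at every `T ∈ (0, Tc)` the value `ρₑ(T)` is identified with a thermal flux-stiffness constant at `β = 1/T`
  (`IsThermalFluxStiffnessSeqAt`).
Compared with `KTDictionaryAt` (p2): the monotonicity field K3 is GONE and the ground-state identification K1b is replaced by the thermal
one K1t. Every field is a HYPOTHESIS. [cite: HazraVermaRanderia2019, eqs. (2)–(3)] -/
structure ThermalKTDictionaryAt (tp U n : ℝ) (ρe : ℝ → ℝ) (Tc : ℝ) : Prop where
  /-- `0 < Tc`. -/
  pos : 0 < Tc
  /-- K2: KT stability inequality for the pair stiffness `ρₑ/2` below `Tc`. -/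
  stable : StableBelow (fun T => phaseStiffnessOfTwistCoeff 2 (ρe T)) Tc
  /-- K1t: at every `T ∈ (0, Tc)`, `ρₑ(T)` is a thermal flux-stiffness constant at `β = 1/T` (sequence-robust form). -/
  thermal : ∀ ⦃T : ℝ⦄, 0 < T → T < Tc → IsThermalFluxStiffnessSeqAt tp U n (1 / T) (ρe T)

namespace ThermalKTDictionaryAt

variable {tp U n : ℝ} {ρe : ℝ → ℝ} {Tc : ℝ}

/-- Under the dictionary the profile is positive below `Tc`: stability gives `0 < (2/π)T ≤ ρₑ(T)/2`. [cite: NelsonKosterlitz1977, eq. (1)] -/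
theorem apply_pos (h : ThermalKTDictionaryAt tp U n ρe Tc) {T : ℝ} (hT : 0 < T) (hTTc : T < Tc) : 0 < ρe T := by
  have h1 : 2 / π * T ≤ phaseStiffnessOfTwistCoeff 2 (ρe T) := h.stable hT hTTc
  rw [phaseStiffnessOfTwistCoeff_two] at h1
  have h2 : 0 < 2 / π * T := by positivity
  linarith

/-- Under the dictionary, a thermal leaf bounds the profile throughout `(0, Tc)`: `ρₑ(T) ≤ c`. No monotonicity is used.
[cite: ScalapinoWhiteZhang1993, §II] -/
theorem apply_le (h : ThermalKTDictionaryAt tp U n ρe Tc) {c : ℚ} (hleaf : ObsThermalStiffnessSeqCeilingAt tp U n c) {T : ℝ}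
    (hT : 0 < T) (hTTc : T < Tc) : ρe T ≤ ((c : ℚ) : ℝ) :=
  (h.thermal hT hTTc).le_of_leaf (one_div_pos.2 hT) (h.apply_pos hT hTTc) hleaf

/-- **Thermal stiffness ceiling ⇒ KT upper bound on `T_c`, WITHOUT monotonicity (any anchor).** If `ObsThermalStiffnessSeqCeilingAt tp U n c`
holds and the profile `ρₑ` with candidate transition temperature `Tc` satisfies the thermal KT dictionary at `(U, n, t′)`, then
`Tc ≤ (π/4)·c` (tree units, `t = 1`): the leaf gives `ρₑ(T) ≤ c` at every `T ∈ (0, Tc)` directly, and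
`le_pi_div_four_mul_of_pairTwistCeiling` (stability for the pair stiffness `ρₑ/2`) concludes. The cell's row grammar
«certified-upper·KT (NK jump assumed; thermal kinetic ceiling, no monotonicity; 2D single-layer model)», keys {K1t, K1b, K2}.
[cite: HazraVermaRanderia2019, eqs. (2)–(3) and App. G] -/
theorem le_pi_div_four_mul (h : ThermalKTDictionaryAt tp U n ρe Tc) {c : ℚ} (hleaf : ObsThermalStiffnessSeqCeilingAt tp U n c) :
    Tc ≤ π / 4 * ((c : ℚ) : ℝ) :=
  le_pi_div_four_mul_of_pairTwistCeiling h.stable h.pos fun _ hT hTTc => h.apply_le hleaf hT hTTc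

/-- **The B3 / B-x row form**: a certified value `ν·n/2 + B(t′, ν) ≤ c` (`0 ≤ n ≤ 2`, any `U`; e.g. an interval-certified box supremum
of the cell's B3-CERTIFIED.md) and the thermal dictionary at `(U, n, t′)` give `Tc ≤ (π/4)·c` — no monotonicity, no claim node.
[cite: HazraVermaRanderia2019, eqs. (2)–(6)] -/
theorem le_pi_div_four_mul_of_halfBathtub_le (h : ThermalKTDictionaryAt tp U n ρe Tc) (hn0 : 0 ≤ n) (hn2 : n ≤ 2) (ν : ℝ)
    (c : ℚ) (hc : ν * n / 2 +
      (∫ y in (-π)..π, ∫ x in (-π)..π,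
          max (Real.cos x + Real.cos y + 4 * tp * (Real.cos x * Real.cos y) - ν) 0) / (4 * π ^ 2) ≤ ((c : ℚ) : ℝ)) :
    Tc ≤ π / 4 * ((c : ℚ) : ℝ) :=
  h.le_pi_div_four_mul (ObsThermalStiffnessSeqCeilingAt_of_halfBathtub_le tp U n hn0 hn2 ν c hc)

/-- **The family row, K3-FREE (cell TC-TABLE A1): `t′ = 0`, EVERY coupling `U`, EVERY density `0 ≤ n ≤ 2`: `Tc ≤ 1/π`**
(`= (π/4)·(4/π²) = 0.3183099…`) for every profile satisfying the thermal KT dictionary at `(U, n, 0)` — no certificate, no claim node, no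
monotonicity (`ObsThermalStiffnessSeqCeilingAt_tp0_kinematic`: every rational `c ≥ 4/π²` is a thermal ceiling; density of `ℚ` in `ℝ` removes
the rounding). [cite: HazraVermaRanderia2019, App. G] -/
theorem le_inv_pi_kinematic {U n : ℝ} (hn0 : 0 ≤ n) (hn2 : n ≤ 2) {ρe : ℝ → ℝ} {Tc : ℝ}
    (h : ThermalKTDictionaryAt 0 U n ρe Tc) : Tc ≤ 1 / π := by
  have hπ : 0 < π := Real.pi_pos
  have hb : ∀ c : ℚ, 4 / π ^ 2 ≤ ((c : ℚ) : ℝ) → Tc ≤ π / 4 * ((c : ℚ) : ℝ) := fun c hc =>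
    h.le_pi_div_four_mul (ObsThermalStiffnessSeqCeilingAt_tp0_kinematic hn0 hn2 c hc)
  refine le_of_forall_pos_lt_add fun ε hε => ?_
  have hεπ : 0 < ε / π := by positivity
  obtain ⟨c, hc1, hc2⟩ := exists_rat_btwn (show 4 / π ^ 2 < 4 / π ^ 2 + ε / π by linarith)
  have h1 := hb c hc1.le
  have h2 : π / 4 * ((c : ℚ) : ℝ) < π / 4 * (4 / π ^ 2 + ε / π) := mul_lt_mul_of_pos_left hc2 (by positivity)
  have h3 : π / 4 * (4 / π ^ 2 + ε / π) = 1 / π + ε / 4 := by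
    field_simp
  linarith

/-- **Any `t′`, the `ν = 0` constant, K3-free: `Tc ≤ π·kinL1 t′/16`** (`= (π/4)·(kinL1 t′/4)`; every `U`, every `0 ≤ n ≤ 2`) for every
profile satisfying the thermal KT dictionary at `(U, n, t′)`; `kinL1` is pub-hubbard's certified one-body column (`kinL1 0 = 16/π²`
recovers `1/π`). [cite: HazraVermaRanderia2019, eqs. (2)–(6)] -/
theorem le_pi_mul_kinL1_div_sixteen (h : ThermalKTDictionaryAt tp U n ρe Tc) (hn0 : 0 ≤ n) (hn2 : n ≤ 2) :
    Tc ≤ π * kinL1 tp / 16 := by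
  have hπ : 0 < π := Real.pi_pos
  have hb : ∀ c : ℚ, kinL1 tp / 4 ≤ ((c : ℚ) : ℝ) → Tc ≤ π / 4 * ((c : ℚ) : ℝ) := fun c hc =>
    h.le_pi_div_four_mul (ObsThermalStiffnessSeqCeilingAt_of_kinL1_le tp U n hn0 hn2 c hc)
  refine le_of_forall_pos_lt_add fun ε hε => ?_
  have hεπ : 0 < ε / π := by positivity
  obtain ⟨c, hc1, hc2⟩ := exists_rat_btwn (show kinL1 tp / 4 < kinL1 tp / 4 + ε / π by linarith)
  have h1 := hb c hc1.le
  have h2 : π / 4 * ((c : ℚ) : ℝ) < π / 4 * (kinL1 tp / 4 + ε / π) := mul_lt_mul_of_pos_left hc2 (by positivity)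
  have h3 : π / 4 * (kinL1 tp / 4 + ε / π) = π * kinL1 tp / 16 + ε / 4 := by
    field_simp
    ring
  linarith

/-- **Interlayer transfer made explicit (key K4-b)**: thermal leaf + thermal dictionary + a stated transfer `T₃ ≤ E·Tc` (`E ≥ 0`, a
MODELLING input printed on the row) ⇒ `T₃ ≤ E·(π/4)·c`. [cite: HazraVermaRanderia2019, eqs. (2)–(3)] -/
theorem layered_le_mul_pi_div_four_mul (h : ThermalKTDictionaryAt tp U n ρe Tc) {c : ℚ}
    (hleaf : ObsThermalStiffnessSeqCeilingAt tp U n c) {T₃ E : ℝ} (hE : 0 ≤ E) (h₃ : T₃ ≤ E * Tc) :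
    T₃ ≤ E * (π / 4 * ((c : ℚ) : ℝ)) :=
  h₃.trans (mul_le_mul_of_nonneg_left (h.le_pi_div_four_mul hleaf) hE)

end ThermalKTDictionaryAt

end Summit.Ventures.CertifiedManyBodySolver.Observables

end
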